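import Summits.HodgeConjecture.HodgeConjecture.Theses.NikulinTwinTransport
import Summits.HodgeConjecture.HodgeConjecture.Theorems.NikulinTwinTransportHodgeIsometryAlgebraic
import Summits.HodgeConjecture.HodgeConjecture.Theorems.NikulinTwinTransportHodgeIsometryAlgebraicGysinBaseChange
import Summits.HodgeConjecture.HodgeConjecture.Theorems.NikulinTwinTransportTwinSimilitudeReduction

/-!
# Route NikulinTwinTransport · item `HodgeIsometryAlgebraic` (stmt-HodgeConjecture-13675) —
# Buskin's Lemma 6.3 (composition of algebraic correspondences between surfaces) from Künneth and
# the multiplicativity of algebraic classes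

Companion to `Theorems/NikulinTwinTransportHodgeIsometryAlgebraicGysinBaseChange` (Gysin base change
for the product square `X ⊗ (Y ⊗ Z) → Y ⊗ Z` over `X ⊗ Y → Y` from the Künneth spanning property,
`gysin_baseChange_of_kunneth`). With that base change the tree's
`Literature.AlgebraicGeometry.HodgeTheory.corr_comp_of_baseChange` (Fulton, *Intersection Theory*,
§16.1; Buskin, Lemma 6.3: `[γ'']_* = [γ]_* ∘ [γ']_*`, `γ'' = p₁₃_*(p₁₂^* γ ∪ p₂₃^* γ')`) and
`corrCompClass_mem_algebraicClasses` (`γ''` is algebraic, granted `N² ∪ N² ⊆ N⁴` on the triple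
product) give:

* `corrComp_surfaces_of_kunneth`, `corrComp_surfaces_of_kunneth'` — composition of algebraic
  degree-`4` correspondences between smooth projective SURFACES acting on `H²`, in the exact shape of
  hypothesis (C) of the glue `Summit.HodgeConjecture.HodgeConjecture.Theorems.similitudeAlgebraic_of_anchor`
  (route target `TwinSimilitudeAlgebraic`, stmt-HodgeConjecture-13674) and of `hcomp₀` of
  `Literature.AlgebraicGeometry.Surfaces.Buskin2019_hodgeIsometry_algebraic_of_reflective_at` /
  `hcomp` of `hodgeIsometryAlgebraic_of_reflective` (this item), GRANTED only
  (hK) the Künneth spanning property for products of smooth projective varieties (Hatcher Thm. 3.15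
  with Cor. A.12) and (hCUP) `N² ∪ N² ⊆ N⁴` on triple products of surfaces (Voisin II Prop. 9.20; the
  moving-lemma input, a hypothesis in the tree by design, cf. `AlgebraicClassesCup`);
* `hodgeIsometryAlgebraic_of_reflective_of_kunneth` — the item from the named facts
  `Huybrechts_K3_periodSurjective_projective`, `Huybrechts_K3_marking_exists`, Buskin's Prop. 6.2 for
  reflective isometries at one orientation family (`hrefl`), `hK` and `hCUP`;
* `twinSimilitudeAlgebraic_of_anchor_of_kunneth` — the route's target from the item, `hK`, `hCUP` and
  the algebraic anchor `2`-similitude (A).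

Conditional results (the closing-form theorems keep named-fact and inline hypotheses); the two
composition theorems are unconditional consequences of `hK` and `hCUP`.

## References

* [Buskin2019] N. Buskin, Every rational Hodge isometry between two K3 surfaces is algebraic,
  J. reine angew. Math. 755 (2019), Thm. 1.1, §6.2 Prop. 6.2, Lemma 6.3.
* [Fulton1998] W. Fulton, Intersection Theory, 2nd ed., Springer 1998, §16.1 Def. 16.1.1, Prop. 16.1.1.
* [VoisinHodgeII2003] C. Voisin, Hodge Theory and Complex Algebraic Geometry II, CUP 2003, §9.2.4 Prop. 9.20.
* [HatcherAT2002] A. Hatcher, Algebraic Topology, CUP 2002, §3.2 Thm. 3.15, Cor. A.12.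
* [Huybrechts2016K3] D. Huybrechts, Lectures on K3 Surfaces, CUP 2016, Ch. 1 Prop. 3.5.
-/

noncomputable section

open CategoryTheory AlgebraicGeometry MonoidalCategory CartesianMonoidalCategory
open Literature.AlgebraicGeometry.Motives Literature.AlgebraicGeometry.HodgeTheory
open Literature.AlgebraicGeometry.Surfaces Literature.Geometry.Kaehler
open Literature.AlgebraicTopology.SingularHomology
open scoped Manifold

namespace Summit.HodgeConjecture.HodgeConjecture.Theorems.NikulinTwinTransport

/-! ### Composition of algebraic correspondences between surfaces -/

/-- **Composition of algebraic correspondences between smooth projective surfaces, from Künneth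
and the multiplicativity of algebraic classes** (Buskin's Lemma 6.3 / Fulton Def. 16.1.1 in the
shape of hypothesis (C) of `Summit.HodgeConjecture.HodgeConjecture.Theorems.similitudeAlgebraic_of_anchor`
and of `hcomp₀` of `Literature.AlgebraicGeometry.Surfaces.Buskin2019_hodgeIsometry_algebraic_of_reflective_at`):
for algebraic `γ ∈ N²H⁴((A ⊗ B)(ℂ))`, `γ₁ ∈ N²H⁴((B ⊗ C)(ℂ))` there is an algebraic
`γ₂ ∈ N²H⁴((A ⊗ C)(ℂ))` with `[γ₂]_* = [γ]_* ∘ [γ₁]_*` on `H²(C(ℂ); ℂ)`, namely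
`γ₂ = c • p₁₃_*(p₁₂^* γ ∪ p₂₃^* γ₁)` (`corr_comp_of_baseChange` with the base change
`gysin_baseChange_of_kunneth`, and `corrCompClass_mem_algebraicClasses`), GRANTED the Künneth spanning
property `hK` and the multiplicativity `N² ∪ N² ⊆ N⁴` on the triple products `A ⊗ (B ⊗ C)` (`hCUP`,
Voisin II Prop. 9.20; the moving-lemma input of the tree's `cupProduct_mem_algebraicClasses_of_moving`).
[cite: Buskin2019, Lemma 6.3] [cite: Fulton1998, §16.1 Def. 16.1.1 and Prop. 16.1.1]
[cite: VoisinHodgeII2003, §9.2.4 Prop. 9.20] -/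
theorem corrComp_surfaces_of_kunneth (μ : OrientationFamily)
    (hK : ∀ ⦃m' n' : ℕ⦄ ⦃Y' Z' : SchemeOver ℂ⦄, IsSmoothProjective m' Y' → IsSmoothProjective n' Z' →
      ∀ (k : ℕ) (z : complexBetti (Y' ⊗ Z') k), z ∈ Submodule.span ℂ
        {v | ∃ (i j : ℕ) (h : i + j = k) (b : complexBetti Y' i) (w : complexBetti Z' j),
          v = cupProduct h (complexBetti.map (fst Y' Z') i b) (complexBetti.map (snd Y' Z') j w)})
    (hCUP : ∀ (A B C : SchemeOver ℂ), IsSmoothProjective 2 A → IsSmoothProjective 2 B →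
      IsSmoothProjective 2 C →
      ∀ a ∈ algebraicClasses (A ⊗ (B ⊗ C)) 2, ∀ b ∈ algebraicClasses (A ⊗ (B ⊗ C)) 2,
        cupProduct ((Nat.mul_add 2 2 2).symm : 2 * 2 + 2 * 2 = 2 * (2 + 2)) a b ∈
          algebraicClasses (A ⊗ (B ⊗ C)) (2 + 2))
    (A B C : SchemeOver ℂ) (hA : IsSmoothProjective 2 A) (hB : IsSmoothProjective 2 B)
    (hC : IsSmoothProjective 2 C) :
    ∀ γ ∈ algebraicClasses (A ⊗ B) 2, ∀ γ₁ ∈ algebraicClasses (B ⊗ C) 2,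
      ∃ γ₂ ∈ algebraicClasses (A ⊗ C) 2, ∀ x : complexBetti C (2 * 1),
        complexGysin μ (IsSmoothProjective.tensor_holds hA hC) hA (fst A C)
            (rfl : 2 * 1 + 2 * 2 + 2 * 2 = 2 * 1 + 2 * (2 + 2))
            (cupProduct (rfl : 2 * 1 + 2 * 2 = 2 * 1 + 2 * 2)
              (complexBetti.map (snd A C) (2 * 1) x) γ₂) =
          complexGysin μ (IsSmoothProjective.tensor_holds hA hB) hA (fst A B)
            (rfl : 2 * 1 + 2 * 2 + 2 * 2 = 2 * 1 + 2 * (2 + 2))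
            (cupProduct (rfl : 2 * 1 + 2 * 2 = 2 * 1 + 2 * 2)
              (complexBetti.map (snd A B) (2 * 1)
                (complexGysin μ (IsSmoothProjective.tensor_holds hB hC) hB (fst B C)
                  (rfl : 2 * 1 + 2 * 2 + 2 * 2 = 2 * 1 + 2 * (2 + 2))
                  (cupProduct (rfl : 2 * 1 + 2 * 2 = 2 * 1 + 2 * 2)
                    (complexBetti.map (snd B C) (2 * 1) x) γ₁)))
              γ) := by
  intro γ hγ γ₁ hγ₁
  have hμ : μ.HasPoincareDuality := OrientationFamily.hasPoincareDuality μ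
  obtain ⟨c, hc⟩ := gysin_baseChange_of_kunneth μ hA hB hC hK
    (show 2 * 1 + 2 * 2 + 2 * 2 = 2 * 1 + 2 * (2 + 2) from rfl)
  refine ⟨c • complexGysin μ
      (IsSmoothProjective.tensor_holds hA (IsSmoothProjective.tensor_holds hB hC))
      (IsSmoothProjective.tensor_holds hA hC) (A ◁ snd B C)
      (show 2 * (2 + 2) + 2 * (2 + 2) = 2 * 2 + 2 * (2 + (2 + 2)) by omega)
      (cupProduct ((Nat.mul_add 2 2 2).symm : 2 * 2 + 2 * 2 = 2 * (2 + 2))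
        (complexBetti.map (A ◁ fst B C) (2 * 2) γ) (complexBetti.map (snd A (B ⊗ C)) (2 * 2) γ₁)),
    Submodule.smul_mem _ c (corrCompClass_mem_algebraicClasses hμ hA hB hC (e := 2) (e' := 2)
      (e'' := 2) rfl (hCUP A B C hA hB hC) hγ hγ₁), fun x ↦ ?_⟩
  exact corr_comp_of_baseChange hμ hA hB hC (e := 2) (j := 2 * 2) (k := 2 * 2) (d := 2 * (2 + 2))
    (a := 2 * 1) (a₁ := 2 * 1) (a₂ := 2 * 1) rfl rfl rfl ((Nat.mul_add 2 2 2).symm) γ γ₁ c hc x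

/-- The same, quantified over orientation families with Poincaré duality — VERBATIM hypothesis (C)
of `Summit.HodgeConjecture.HodgeConjecture.Theorems.similitudeAlgebraic_of_anchor` /
`twinSimilitudeAlgebraic_of_anchor` / `hodgeSimilitudeAlgebraic_of_anchor` (the glue of the route's
target `TwinSimilitudeAlgebraic`, stmt-HodgeConjecture-13674), now reduced to `hK` and `hCUP`.
[cite: Buskin2019, Lemma 6.3] [cite: Fulton1998, §16.1 Def. 16.1.1 and Prop. 16.1.1] -/
theorem corrComp_surfaces_of_kunneth' 
    (hK : ∀ ⦃m' n' : ℕ⦄ ⦃Y' Z' : SchemeOver ℂ⦄, IsSmoothProjective m' Y' → IsSmoothProjective n' Z' →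
      ∀ (k : ℕ) (z : complexBetti (Y' ⊗ Z') k), z ∈ Submodule.span ℂ
        {v | ∃ (i j : ℕ) (h : i + j = k) (b : complexBetti Y' i) (w : complexBetti Z' j),
          v = cupProduct h (complexBetti.map (fst Y' Z') i b) (complexBetti.map (snd Y' Z') j w)})
    (hCUP : ∀ (A B C : SchemeOver ℂ), IsSmoothProjective 2 A → IsSmoothProjective 2 B →
      IsSmoothProjective 2 C →
      ∀ a ∈ algebraicClasses (A ⊗ (B ⊗ C)) 2, ∀ b ∈ algebraicClasses (A ⊗ (B ⊗ C)) 2,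
        cupProduct ((Nat.mul_add 2 2 2).symm : 2 * 2 + 2 * 2 = 2 * (2 + 2)) a b ∈
          algebraicClasses (A ⊗ (B ⊗ C)) (2 + 2)) :
    ∀ (μ : OrientationFamily), μ.HasPoincareDuality →
      ∀ (A B C : SchemeOver ℂ) (hA : IsSmoothProjective 2 A) (hB : IsSmoothProjective 2 B)
        (hC : IsSmoothProjective 2 C),
        ∀ γ ∈ algebraicClasses (MonoidalCategoryStruct.tensorObj A B) 2,
          ∀ γ₁ ∈ algebraicClasses (MonoidalCategoryStruct.tensorObj B C) 2,
            ∃ γ₂ ∈ algebraicClasses (MonoidalCategoryStruct.tensorObj A C) 2,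
              ∀ x : complexBetti C (2 * 1),
                complexGysin μ (IsSmoothProjective.tensor_holds hA hC) hA
                    (SemiCartesianMonoidalCategory.fst A C)
                    (rfl : 2 * 1 + 2 * 2 + 2 * 2 = 2 * 1 + 2 * (2 + 2))
                    (cupProduct (rfl : 2 * 1 + 2 * 2 = 2 * 1 + 2 * 2)
                      (complexBetti.map (SemiCartesianMonoidalCategory.snd A C) (2 * 1) x) γ₂) =
                  complexGysin μ (IsSmoothProjective.tensor_holds hA hB) hA
                    (SemiCartesianMonoidalCategory.fst A B)
                    (rfl : 2 * 1 + 2 * 2 + 2 * 2 = 2 * 1 + 2 * (2 + 2))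
                    (cupProduct (rfl : 2 * 1 + 2 * 2 = 2 * 1 + 2 * 2)
                      (complexBetti.map (SemiCartesianMonoidalCategory.snd A B) (2 * 1)
                        (complexGysin μ (IsSmoothProjective.tensor_holds hB hC) hB
                          (SemiCartesianMonoidalCategory.fst B C)
                          (rfl : 2 * 1 + 2 * 2 + 2 * 2 = 2 * 1 + 2 * (2 + 2))
                          (cupProduct (rfl : 2 * 1 + 2 * 2 = 2 * 1 + 2 * 2)
                            (complexBetti.map (SemiCartesianMonoidalCategory.snd B C) (2 * 1) x)
                            γ₁)))
                      γ) :=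
  fun μ _ A B C hA hB hC ↦ corrComp_surfaces_of_kunneth μ hK hCUP A B C hA hB hC

/-! ### What the items now hinge on -/

/-- `MarkedK3[S, η, p, x]`: a marked K3 surface with period `x` (copied from
`Theorems/NikulinTwinTransportHodgeIsometryAlgebraic`). Local notation only. -/
local notation3 (prettyPrint := false) "MarkedK3[" S ", " η ", " p ", " x "]" =>
  (IsIntegralClass p ∧
    (∀ q : complexBetti S (2 * 2), IsIntegralClass q → ∃ n : ℤ, q = n • p) ∧
    (∀ c : complexBetti S (2 * 1), IsIntegralClass c ↔ ∃ v : K3Index → ℤ, η c = fun i => (v i : ℂ)) ∧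
    (∀ a b : complexBetti S (2 * 1),
        cupProduct (rfl : 2 * 1 + 2 * 1 = 2 * 2) a b = k3Form (η a) (η b) • p) ∧
    IsOfHodgeType 2 S (2 * 1) 2 0 (LinearEquiv.symm η x) ∧
    (∀ τ : complexBetti S (2 * 1), IsOfHodgeType 2 S (2 * 1) 2 0 τ → ∃ t : ℂ, τ = t • LinearEquiv.symm η x))

/-- `PeriodPt[x]`: a projective period point (copied from
`Theorems/NikulinTwinTransportHodgeIsometryAlgebraic`). Local notation only. -/
local notation3 (prettyPrint := false) "PeriodPt[" x "]" =>
  (k3Form x x = 0 ∧ 0 < (k3Form (star x) x).re ∧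
    ∃ u : K3Index → ℤ, k3Form (fun i => (u i : ℂ)) x = 0 ∧ 0 < ∑ i, ∑ j, u i * k3Gram i j * u j)

/-- `Corr[μ, S, S', hS, hS' ; γ, y] = [γ]_* y = fst_* (snd^* y ∪ γ)` (copied from
`Theorems/NikulinTwinTransportHodgeIsometryAlgebraic`). Local notation only. -/
local notation3 (prettyPrint := false) "Corr[" μ ", " S ", " S' ", " hS ", " hS' " ; " γ ", " y "]" =>
  complexGysin μ
    (IsSmoothProjective.tensor_holds (IsK3Surface.isSmoothProjective hS)
      (IsK3Surface.isSmoothProjective hS'))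
    (IsK3Surface.isSmoothProjective hS) (SemiCartesianMonoidalCategory.fst S S')
    (rfl : 2 * 1 + 2 * 2 + 2 * 2 = 2 * 1 + 2 * (2 + 2))
    (cupProduct (rfl : 2 * 1 + 2 * 2 = 2 * 1 + 2 * 2)
      (complexBetti.map (SemiCartesianMonoidalCategory.snd S S') (2 * 1) y) γ)

/-- **What the item `HodgeIsometryAlgebraic` (stmt-HodgeConjecture-13675) hinges on, after this
file**: the named facts `Huybrechts_K3_periodSurjective_projective` and `Huybrechts_K3_marking_exists`,
Buskin's Prop. 6.2 for reflective isometries at one orientation family `μ₀` (`hrefl`), the Künneth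
spanning property `hK` (Hatcher Thm. 3.15) and the multiplicativity `hCUP` of algebraic classes on
triple products of surfaces (Voisin II Prop. 9.20) — Buskin's Lemma 6.3 (the former hypothesis
`hcomp` of `hodgeIsometryAlgebraic_of_reflective`) being DISCHARGED from `hK` and `hCUP` by
`corrComp_surfaces_of_kunneth`. Conditional on the two named facts and the three inline hypotheses.
[cite: Buskin2019, Thm. 1.1 and §6.2 (Prop. 6.2, Lemma 6.3)] [cite: HatcherAT2002, §3.2 Thm. 3.15]
[cite: VoisinHodgeII2003, §9.2.4 Prop. 9.20] -/
theorem hodgeIsometryAlgebraic_of_reflective_of_kunneth (μ₀ : OrientationFamily)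
    (h : Huybrechts_K3_periodSurjective_projective) (hmark : Huybrechts_K3_marking_exists)
    (hrefl : ∀ (S S' : SchemeOver ℂ) (hS : IsK3Surface S) (hS' : IsK3Surface S')
      (η : complexBetti S (2 * 1) ≃ₗ[ℂ] (K3Index → ℂ)) (p : complexBetti S (2 * 2)) (x : K3Index → ℂ)
      (η' : complexBetti S' (2 * 1) ≃ₗ[ℂ] (K3Index → ℂ)) (p' : complexBetti S' (2 * 2))
      (x' : K3Index → ℂ),
      MarkedK3[S, η, p, x] → PeriodPt[x] → MarkedK3[S', η', p', x'] → PeriodPt[x'] →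
      ∀ v : K3Index → ℤ, ∑ i, ∑ j, v i * k3Gram i j * v j ≠ 0 →
      (∃ t : ℂ, k3ReflectionC v x' = t • x) →
      ∃ γ ∈ algebraicClasses (S ⊗ S') 2, ∀ y : complexBetti S' (2 * 1),
        η.symm (k3ReflectionC v (η' y)) = Corr[μ₀, S, S', hS, hS' ; γ, y])
    (hK : ∀ ⦃m' n' : ℕ⦄ ⦃Y' Z' : SchemeOver ℂ⦄, IsSmoothProjective m' Y' → IsSmoothProjective n' Z' →
      ∀ (k : ℕ) (z : complexBetti (Y' ⊗ Z') k), z ∈ Submodule.span ℂ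
        {v | ∃ (i j : ℕ) (h : i + j = k) (b : complexBetti Y' i) (w : complexBetti Z' j),
          v = cupProduct h (complexBetti.map (fst Y' Z') i b) (complexBetti.map (snd Y' Z') j w)})
    (hCUP : ∀ (A B C : SchemeOver ℂ), IsSmoothProjective 2 A → IsSmoothProjective 2 B →
      IsSmoothProjective 2 C →
      ∀ a ∈ algebraicClasses (A ⊗ (B ⊗ C)) 2, ∀ b ∈ algebraicClasses (A ⊗ (B ⊗ C)) 2,
        cupProduct ((Nat.mul_add 2 2 2).symm : 2 * 2 + 2 * 2 = 2 * (2 + 2)) a b ∈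
          algebraicClasses (A ⊗ (B ⊗ C)) (2 + 2)) :
    Theses.NikulinTwinTransport.HodgeIsometryAlgebraic :=
  hodgeIsometryAlgebraic_of_reflective μ₀ h hmark hrefl fun S S' S'' hS hS' hS'' γ hγ γ' hγ' ↦
    corrComp_surfaces_of_kunneth μ₀ hK hCUP S S' S'' hS.1 hS'.1 hS''.1 γ hγ γ' hγ'

/-- **What the route's target `TwinSimilitudeAlgebraic` (stmt-HodgeConjecture-13674) hinges on, after
this file**: the item `HodgeIsometryAlgebraic` (Buskin), the Künneth spanning property `hK`, the
multiplicativity `hCUP`, and the algebraic anchor `2`-similitude (A) of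
`twinSimilitudeAlgebraic_of_anchor` — hypothesis (C) of that glue being DISCHARGED from `hK` and
`hCUP`. [cite: Buskin2019, Thm. 1.1 and Lemma 6.3] [cite: HatcherAT2002, §3.2 Thm. 3.15] -/
theorem twinSimilitudeAlgebraic_of_anchor_of_kunneth
    (hB : Theses.NikulinTwinTransport.HodgeIsometryAlgebraic)
    (hK : ∀ ⦃m' n' : ℕ⦄ ⦃Y' Z' : SchemeOver ℂ⦄, IsSmoothProjective m' Y' → IsSmoothProjective n' Z' →
      ∀ (k : ℕ) (z : complexBetti (Y' ⊗ Z') k), z ∈ Submodule.span ℂ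
        {v | ∃ (i j : ℕ) (h : i + j = k) (b : complexBetti Y' i) (w : complexBetti Z' j),
          v = cupProduct h (complexBetti.map (fst Y' Z') i b) (complexBetti.map (snd Y' Z') j w)})
    (hCUP : ∀ (A B C : SchemeOver ℂ), IsSmoothProjective 2 A → IsSmoothProjective 2 B →
      IsSmoothProjective 2 C →
      ∀ a ∈ algebraicClasses (A ⊗ (B ⊗ C)) 2, ∀ b ∈ algebraicClasses (A ⊗ (B ⊗ C)) 2,
        cupProduct ((Nat.mul_add 2 2 2).symm : 2 * 2 + 2 * 2 = 2 * (2 + 2)) a b ∈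
          algebraicClasses (A ⊗ (B ⊗ C)) (2 + 2))
    (hA : ∀ (μ : OrientationFamily), μ.HasPoincareDuality →
      ∀ (S : SchemeOver ℂ)
        (hS : (IsSmoothProjective 2 S ∧ Subsingleton (structureSheafCohomology S.left 1) ∧
          ∃ (A : HodgeModel 2 S) (η : MForm 𝓘(ℝ, A.model) A.carrier ℂ 2),
            IsHolomorphicInCharts η ∧ ∀ x, η x ≠ 0))
        (p : complexBetti S (2 * 2)),
        (IsIntegralClass p ∧ ∀ q : complexBetti S (2 * 2), IsIntegralClass q → ∃ n : ℤ, q = n • p) →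
        ∃ (S'' : SchemeOver ℂ)
          (hS'' : (IsSmoothProjective 2 S'' ∧ Subsingleton (structureSheafCohomology S''.left 1) ∧
            ∃ (A : HodgeModel 2 S'') (η : MForm 𝓘(ℝ, A.model) A.carrier ℂ 2),
              IsHolomorphicInCharts η ∧ ∀ x, η x ≠ 0))
          (p'' : complexBetti S'' (2 * 2)),
          (IsIntegralClass p'' ∧
            ∀ q : complexBetti S'' (2 * 2), IsIntegralClass q → ∃ n : ℤ, q = n • p'') ∧
          ∃ Ψ : complexBetti S'' (2 * 1) ≃ₗ[ℂ] complexBetti S (2 * 1),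
            (∀ y, IsRationalClass y → IsRationalClass (Ψ.symm y)) ∧
            (∀ (i j : ℕ) y, IsOfHodgeType 2 S (2 * 1) i j y →
              IsOfHodgeType 2 S'' (2 * 1) i j (Ψ.symm y)) ∧
            (∀ (u v : complexBetti S (2 * 1)) (b : ℂ),
              cupProduct (rfl : 2 * 1 + 2 * 1 = 2 * 2) u v = (2 * b) • p →
                cupProduct (rfl : 2 * 1 + 2 * 1 = 2 * 2) (Ψ.symm u) (Ψ.symm v) = b • p'') ∧
            ∃ γ ∈ algebraicClasses (MonoidalCategoryStruct.tensorObj S S'') 2,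
              ∀ x : complexBetti S'' (2 * 1),
                Ψ x = complexGysin μ (IsSmoothProjective.tensor_holds hS.1 hS''.1) hS.1
                  (SemiCartesianMonoidalCategory.fst S S'')
                  (rfl : 2 * 1 + 2 * 2 + 2 * 2 = 2 * 1 + 2 * (2 + 2))
                  (cupProduct (rfl : 2 * 1 + 2 * 2 = 2 * 1 + 2 * 2)
                    (complexBetti.map (SemiCartesianMonoidalCategory.snd S S'') (2 * 1) x) γ)) :
    Theses.NikulinTwinTransport.TwinSimilitudeAlgebraic :=
  twinSimilitudeAlgebraic_of_anchor hB (corrComp_surfaces_of_kunneth' hK hCUP) hA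

end Summit.HodgeConjecture.HodgeConjecture.Theorems.NikulinTwinTransport

end
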